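import Summits.QuantumFields.YangMills.Theorems.BalabanUVNodesN15BumpProfile
import Summits.QuantumFields.YangMills.Theorems.BalabanUVNodesN15PartitionSupport
import Summits.QuantumFields.YangMills.Theorems.BalabanUVNodesN15TwoSpacingGluingCommutator
import HarnessLib

/-!
# THE SMOOTH CUT-OFF WITH A PLATEAU, II: the LATTICE SAMPLING `χ̃_k(x) = Π_ν B_{K,R}(ξ_ν(x) − k_ν)` on ANY carrier — PLATEAU `{|v_K(ξ_ν − k_ν)| ≤ R ∀ν}`, SUPPORT inside
# `{< R + 1 ∀ν}`, `0 ≤ χ̃ ≤ 1`, `|∇^±_μχ̃_k| ≤ |n|π|s|`, the value fit across two coordinate systems, the multiplication-operator identities against any input cut `χ = 1` one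
# step beyond the support (`M_{χ̃}M_χ`, `M_{χ̃∘e^{±1}}M_χ`, `M_{∇^±χ̃}M_χ` and the commuted forms), and the PLATEAU FOR THE PARTITION: `R ≥ 1 + |s|` ⟹ `χ̃_k = 1` at `x, e_μx, e_μ⁻¹x`
# whenever `h_k(x) ≠ 0` ⟹ `M_{h_k}∘∇*_μ∇_μ∘M_{1−χ̃_k} = 0`, `M_{h_k}∘(Σ∇*∇ + W)∘M_{1−χ̃_k} = 0` (dag-n15-w4 g3, width seat on N15 = NE2; dag-n15-w3 g4's located item (r2))

Cell `pub-ymgap`, seat `pub-ymgap-dag-n15-w4` (director №399 (3a) width; HUMAN RULING D-0062), generation 3.  `bears_on: R4∕N15 · K3⁸ SpineGivenEndpointR13SepCoPHV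
(stmt-QuantumFields-27366)`.  Filed `--supports stmt-QuantumFields-27366 --as helper` — COUNT-NEUTRAL.  One plumbing `def` (`bcube`; review-queued, D-0009), the rest theorems;
0 `sorry`.  Imports BY NAME this seat's FILE I `…N15BumpProfile` (`bumpPer` and its letters), dag-n15-c FILE 62 `…N15PartitionSupport` (`mulOp_comp_mulOp_of_support`,
`abs_cenRep_lt_one_of_hcube_ne_zero`; through it FILE 61 `hcube` and FILE 60 `cenRep`, `abs_abs_cenRep_sub_le`, `cenRep_add_int_mul`), FILE 46 `…TwoSpacingGluingCommutator` (`lapDir`,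
`lapOp`), g8 `fgrad`∕`bgrad`∕`fgradAdj`, [B6] port `mulOp`.  Nothing in the tree is modified.

WHY.  Files 44∕45 of dag-n15-w3's `…N15.CurvedSpecies` lineage (`hasMaj_glueInv_smoothCutDressed`, `glueInv_smoothCutDressed_inverse`, `hasMaj_idef_glueInv_smoothCutDressed`) and dag-n15-w3
g5's gauged capstones display per cube a bump `χ̃_k` through the hypothesis family `hχt` (`|χ̃| ≤ 1`), `hdχt`∕`hdχtb` (`|∇^±χ̃| ≤ c_t`), `hsub`∕`hχ` (`M_{χ̃}M_χ = M_{χ̃} = M_χM_{χ̃}`),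
`hs`∕`hsb`∕`hs2`∕`hsb2` (the same for `χ̃∘τ_μ^{±1}`), `hdd`∕`hddb`∕`hdd2`∕`hddb2` (the same for `∇^±_μχ̃`), the fits `hfitχ`∕`hfit₁`∕`hfit₁b` (values across `π`), and the plateau
identity `hL : M_{h_k}∘lapOp n e W∘M_{1−χ̃_k} = 0`.  THIS FILE produces them for the sampled bump on any carrier `X` with one-step shifts `e_μ` and real coordinates `ξ_ν` moving by
`s` (mod `K`) under `e_ν` — FILE 61's setting, so a consumer on `X × ι` with `liftEquiv (τ μ) ι` reads them at `ξ ν p := ξ₀ ν p.1` (`bcube_comp_fst`): §1 `bcube`, size, ★ PLATEAU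
`bcube_eq_one_of_forall_abs_cenRep_le`, ★ SUPPORT `bcube_eq_zero_of_exists_le_abs_cenRep` ∕ `abs_cenRep_lt_of_bcube_ne_zero`, ★★ `abs_bcube_sub_bcube_le` (two carriers, two coordinate
systems: `≤ πΣ_ν|v_K(ξ_ν x − ξ′_ν x′)|` — the fits `hfitχ`∕`hfit₁`∕`hfit₁b` once the coordinate fit is read); §2 under FILE 61's shift compatibility `hξ`: `bcube_shift(_symm)`, ★★
`abs_fgrad_bcube_le` ∕ `abs_bgrad_bcube_le` (`≤ |n|π|s|` = `hdχt`∕`hdχtb`); §3 FILE 62's twins against ANY `χ` with `χ x = 1` whenever `x`, `e_μx` or `e_μ⁻¹x` lies in the open box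
`{∀ν, |v_K(ξ_ν · − k_ν)| < R + 1}`: ★★ `bcube_cut`, `cut_bcube`, `bcube_comp_shift_cut` ∕ `cut_bcube_comp_shift`, `bcube_comp_shift_symm_cut` ∕ `cut_bcube_comp_shift_symm`,
`fgrad_bcube_cut` ∕ `cut_fgrad_bcube`, `bgrad_bcube_cut` ∕ `cut_bgrad_bcube` (= `hsub hχ hs hs2 hsb hsb2 hdd hdd2 hddb hddb2` in both grids), NON-VACUOUS by ★ `bcube_wider_eq_one_of_near_box`
(a wider bump `R′ ≥ R + 1 + |s|` is an admissible input cut); §4 ★★ `bcube_eq_one_of_hcube_ne_zero`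
(`R ≥ 1 + |s|`) ⟹ ★★ `mulOp_comp_lapDir_comp_mulOp_one_sub_eq_zero` (any `h, χ̃` with the three-point plateau property) ⟹ ★★★ `mulOp_hcube_comp_lapOp_comp_one_sub_bcube` (= `hL`, given
the displayed locality `M_{h_k}∘W∘M_{1−χ̃_k} = 0` of the potential part — e.g. `W` a multiplication operator, `mulOp_comp_mulOp_comp_mulOp_one_sub_eq_zero`).

HONEST FRAMING ∕ LIMITS.  Elementary support∕product bookkeeping; [B6] (2.36) p.229, (2.91) p.239 and [B9] (3.62)–(3.65) pp.402–403 are SHAPES only — nothing of [B5]∕[B6]∕[B9]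
asserted; the consumer's cube geometry (`R`, the input cut `χ_□`, the blocks `S_k`, `hSχ`) is displayed, not chosen.  NE2⁺ NOT PRINTED, NOT proved; N15 NOT discharged; counts of
record UNMOVED (typed 28∕28 · discharged 5∕27); one finite 𝕋⁴ at fixed ε — NOT infinite volume, NOT OS on ℝ⁴, NOT a mass gap, NOT Clay; R4 closes the conditional finite-𝕋⁴ rung
`BalabanLadder.UV` only.  Restate-immune (no Theses import).
-/

noncomputable section

namespace Summit.QuantumFields.YangMills.BalabanUVNodes.N15.Gluing

open Real
open Literature.MathematicalPhysics.QuantumFieldTheory.Balaban1983to89.B6Prop26Gluing (mulOp mulOp_apply)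
open Summit.QuantumFields.YangMills.BalabanUVNodes.N15.BackgroundLayer (fgrad fgradAdj bgrad fgrad_apply fgradAdj_apply bgrad_apply)

/-! ## §1 The sampled bump: size, plateau, support, modulus of continuity -/

section Lattice

variable {X : Type} {J : Type} [Fintype J] [DecidableEq J] (K : ℕ) (ξ : J → X → ℝ) (R : ℝ)

/-- **THE SAMPLED BUMP** `χ̃_k(x) = Π_ν B_{K,R}(ξ_ν(x) − k_ν)`, `k ∈ (ℤ∕K)^J` — same centres and coordinates as FILE 61's partition `h_k`. [cite: Balaban1985BackgroundPropagators, (3.62)–(3.65) pp.402–403 (the smooth cut-off of the enlarged cube: shape)] -/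
def bcube (k : J → ZMod K) (x : X) : ℝ := ∏ ν, bumpPer K R (ξ ν x - ((k ν).val : ℝ))

omit [DecidableEq J] in
/-- Reading on a product carrier through the first factor is definitional. [folklore] -/
theorem bcube_comp_fst {ι : Type} (k : J → ZMod K) : bcube K (fun ν (p : X × ι) => ξ ν p.1) R k = fun p => bcube K ξ R k p.1 := rfl

omit [DecidableEq J] in
/-- `0 ≤ χ̃_k`. [folklore] -/
theorem bcube_nonneg (k : J → ZMod K) (x : X) : 0 ≤ bcube K ξ R k x := Finset.prod_nonneg fun _ _ => bumpPer_nonneg K R _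

omit [DecidableEq J] in
/-- `χ̃_k ≤ 1`. [folklore] -/
theorem bcube_le_one (k : J → ZMod K) (x : X) : bcube K ξ R k x ≤ 1 :=
  Finset.prod_le_one (fun _ _ => bumpPer_nonneg K R _) fun _ _ => bumpPer_le_one K R _

omit [DecidableEq J] in
/-- ★ `|χ̃_k| ≤ 1` (files 44∕45's `hχt`). [folklore] -/
theorem abs_bcube_le_one (k : J → ZMod K) (x : X) : |bcube K ξ R k x| ≤ 1 := by
  rw [abs_of_nonneg (bcube_nonneg K ξ R k x)]; exact bcube_le_one K ξ R k x

omit [DecidableEq J] in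
/-- ★ **THE PLATEAU**: every coordinate within circle distance `R` of the centre ⟹ `χ̃_k(x) = 1`. [cite: Balaban1985BackgroundPropagators, (3.62)–(3.65) pp.402–403 (shape)] -/
theorem bcube_eq_one_of_forall_abs_cenRep_le {k : J → ZMod K} {x : X} (h : ∀ ν, |cenRep K (ξ ν x - ((k ν).val : ℝ))| ≤ R) : bcube K ξ R k x = 1 :=
  Finset.prod_eq_one fun ν _ => bumpPer_eq_one_of_abs_cenRep_le (h ν)

omit [DecidableEq J] in
/-- ★ **THE SUPPORT**: one coordinate at circle distance `≥ R + 1` ⟹ `χ̃_k(x) = 0`. [cite: Balaban1985BackgroundPropagators, (3.62)–(3.65) pp.402–403 (shape)] -/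
theorem bcube_eq_zero_of_exists_le_abs_cenRep {k : J → ZMod K} {x : X} (h : ∃ ν, R + 1 ≤ |cenRep K (ξ ν x - ((k ν).val : ℝ))|) : bcube K ξ R k x = 0 := by
  obtain ⟨ν, hν⟩ := h
  exact Finset.prod_eq_zero (Finset.mem_univ ν) (bumpPer_eq_zero_of_le_abs_cenRep hν)

omit [DecidableEq J] in
/-- Contrapositive: `χ̃_k(x) ≠ 0` forces every coordinate into the open box `|v_K(ξ_ν x − k_ν)| < R + 1`. [folklore] -/
theorem abs_cenRep_lt_of_bcube_ne_zero {k : J → ZMod K} {x : X} (h : bcube K ξ R k x ≠ 0) (ν : J) : |cenRep K (ξ ν x - ((k ν).val : ℝ))| < R + 1 := by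
  by_contra hc
  exact h (bcube_eq_zero_of_exists_le_abs_cenRep K ξ R ⟨ν, not_lt.1 hc⟩)

omit [DecidableEq J] in
/-- ★★ **THE MODULUS OF CONTINUITY ∕ VALUE FIT between two coordinate systems on two carriers**: `|χ̃_k(x) − χ̃′_k(x′)| ≤ π·Σ_ν|v_K(ξ_ν x − ξ′_ν x′)|` (files 44∕45's `hfitχ`,
`hfit₁`, `hfit₁b` once the consumer's coordinate fit is read; FILE 56's `ℓ, ω` letters for any block geometry). [cite: Balaban1985BackgroundPropagators, Thm 3.14 pp.426–427 (two-grid comparison: template)] -/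
theorem abs_bcube_sub_bcube_le {X₂ : Type} (ξ₂ : J → X₂ → ℝ) (hK : 0 < K) (k : J → ZMod K) (x : X) (x₂ : X₂) :
    |bcube K ξ R k x - bcube K ξ₂ R k x₂| ≤ π * ∑ ν, |cenRep K (ξ ν x - ξ₂ ν x₂)| := by
  classical
  unfold bcube
  refine (abs_prod_sub_prod_le Finset.univ _ _ (fun ν => ⟨bumpPer_nonneg K R _, bumpPer_le_one K R _⟩) (fun ν => ⟨bumpPer_nonneg K R _, bumpPer_le_one K R _⟩)).trans ?_
  rw [Finset.mul_sum]
  refine Finset.sum_le_sum fun ν _ => ?_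
  refine (abs_bumpPer_sub_le_cenRep hK R _ _).trans (le_of_eq ?_)
  rw [show ξ ν x - ((k ν).val : ℝ) - (ξ₂ ν x₂ - ((k ν).val : ℝ)) = ξ ν x - ξ₂ ν x₂ by ring]

/-! ## §2 Shifts and the difference-quotient letters -/

variable (e : J → X ≃ X) {s : ℝ}

/-- Under the shift compatibility, the sample at `e_μ x` is the one-coordinate move `+s`. [folklore] -/
theorem bcube_shift (hK : 0 < K) (hξ : ∀ μ ν x, ∃ z : ℤ, ξ ν (e μ x) = ξ ν x + (if ν = μ then s else 0) + z * K) (k : J → ZMod K) (μ : J) (x : X) :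
    bcube K ξ R k (e μ x) = ∏ ν, bumpPer K R (ξ ν x + (if ν = μ then s else 0) - ((k ν).val : ℝ)) := by
  unfold bcube
  refine Finset.prod_congr rfl fun ν _ => ?_
  obtain ⟨z, hz⟩ := hξ μ ν x
  rw [hz, show ξ ν x + (if ν = μ then s else 0) + z * K - ((k ν).val : ℝ) = (ξ ν x + (if ν = μ then s else 0) - ((k ν).val : ℝ)) + z * K by ring, bumpPer_add_int_mul hK]

/-- … and at `e_μ⁻¹ x` the move `−s`. [folklore] -/
theorem bcube_shift_symm (hK : 0 < K) (hξ : ∀ μ ν x, ∃ z : ℤ, ξ ν (e μ x) = ξ ν x + (if ν = μ then s else 0) + z * K) (k : J → ZMod K) (μ : J) (x : X) :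
    bcube K ξ R k ((e μ).symm x) = ∏ ν, bumpPer K R (ξ ν x - (if ν = μ then s else 0) - ((k ν).val : ℝ)) := by
  unfold bcube
  refine Finset.prod_congr rfl fun ν _ => ?_
  obtain ⟨z, hz⟩ := hξ μ ν ((e μ).symm x)
  rw [Equiv.apply_symm_apply] at hz
  have hz' : ξ ν ((e μ).symm x) = (ξ ν x - (if ν = μ then s else 0) - ((k ν).val : ℝ)) + (-z : ℤ) * K + ((k ν).val : ℝ) := by push_cast; linarith
  rw [hz', show (ξ ν x - (if ν = μ then s else 0) - ((k ν).val : ℝ)) + (-z : ℤ) * K + ((k ν).val : ℝ) - ((k ν).val : ℝ) =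
    (ξ ν x - (if ν = μ then s else 0) - ((k ν).val : ℝ)) + (-z : ℤ) * K by ring, bumpPer_add_int_mul hK]

/-- Splitting off the factor `μ` (`+c`). [folklore] -/
theorem bprod_shift_eq (k : J → ZMod K) (μ : J) (x : X) (c : ℝ) :
    ∏ ν, bumpPer K R (ξ ν x + (if ν = μ then c else 0) - ((k ν).val : ℝ)) =
      bumpPer K R (ξ μ x + c - ((k μ).val : ℝ)) * ∏ ν ∈ Finset.univ.erase μ, bumpPer K R (ξ ν x - ((k ν).val : ℝ)) := by
  rw [← Finset.mul_prod_erase Finset.univ _ (Finset.mem_univ μ), if_pos rfl]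
  congr 1
  exact Finset.prod_congr rfl fun ν hν => by rw [if_neg (Finset.ne_of_mem_erase hν), add_zero]

/-- Splitting off the factor `μ` (`−c`). [folklore] -/
theorem bprod_shift_eq' (k : J → ZMod K) (μ : J) (x : X) (c : ℝ) :
    ∏ ν, bumpPer K R (ξ ν x - (if ν = μ then c else 0) - ((k ν).val : ℝ)) =
      bumpPer K R (ξ μ x - c - ((k μ).val : ℝ)) * ∏ ν ∈ Finset.univ.erase μ, bumpPer K R (ξ ν x - ((k ν).val : ℝ)) := by
  rw [← Finset.mul_prod_erase Finset.univ _ (Finset.mem_univ μ), if_pos rfl]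
  congr 1
  exact Finset.prod_congr rfl fun ν hν => by rw [if_neg (Finset.ne_of_mem_erase hν), sub_zero]

/-- The complementary product is in `[0, 1]`. [folklore] -/
theorem bprod_erase_mem (k : J → ZMod K) (μ : J) (x : X) :
    0 ≤ ∏ ν ∈ Finset.univ.erase μ, bumpPer K R (ξ ν x - ((k ν).val : ℝ)) ∧ ∏ ν ∈ Finset.univ.erase μ, bumpPer K R (ξ ν x - ((k ν).val : ℝ)) ≤ 1 :=
  ⟨Finset.prod_nonneg fun _ _ => bumpPer_nonneg K R _, Finset.prod_le_one (fun _ _ => bumpPer_nonneg K R _) fun _ _ => bumpPer_le_one K R _⟩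

/-- The unshifted sample split at `μ`. [folklore] -/
theorem bcube_eq_mul (k : J → ZMod K) (μ : J) (x : X) :
    bcube K ξ R k x = bumpPer K R (ξ μ x - ((k μ).val : ℝ)) * ∏ ν ∈ Finset.univ.erase μ, bumpPer K R (ξ ν x - ((k ν).val : ℝ)) := by
  rw [bcube, ← Finset.mul_prod_erase Finset.univ _ (Finset.mem_univ μ)]

/-- ★★ **`hdχt` DISCHARGED**: `|∇_μ χ̃_k(x)| = |n|·|χ̃_k(e_μx) − χ̃_k(x)| ≤ |n|π|s|`. [cite: Balaban1985BackgroundPropagators, (3.62)–(3.65) pp.402–403 («|∂χ̃| ≤ O(1)M⁻¹»: shape)] -/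
theorem abs_fgrad_bcube_le (hK : 0 < K) (hξ : ∀ μ ν x, ∃ z : ℤ, ξ ν (e μ x) = ξ ν x + (if ν = μ then s else 0) + z * K) (n : ℝ) (k : J → ZMod K) (μ : J) (x : X) :
    |fgrad n (e μ) (bcube K ξ R k) x| ≤ |n| * (π * |s|) := by
  rw [fgrad_apply, abs_mul]
  refine mul_le_mul_of_nonneg_left ?_ (abs_nonneg _)
  rw [bcube_shift K ξ R e hK hξ, bprod_shift_eq, bcube_eq_mul K ξ R k μ x, ← sub_mul, abs_mul, abs_of_nonneg (bprod_erase_mem K ξ R k μ x).1]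
  refine (mul_le_of_le_one_right (abs_nonneg _) (bprod_erase_mem K ξ R k μ x).2).trans ?_
  refine (abs_bumpPer_sub_le hK R _ _).trans (le_of_eq ?_)
  rw [show ξ μ x + s - ((k μ).val : ℝ) - (ξ μ x - ((k μ).val : ℝ)) = s by ring]

/-- ★★ **`hdχtb` DISCHARGED**: `|∇⁻_μ χ̃_k(x)| ≤ |n|π|s|`. [cite: Balaban1985BackgroundPropagators, (3.62)–(3.65) pp.402–403 (shape)] -/
theorem abs_bgrad_bcube_le (hK : 0 < K) (hξ : ∀ μ ν x, ∃ z : ℤ, ξ ν (e μ x) = ξ ν x + (if ν = μ then s else 0) + z * K) (n : ℝ) (k : J → ZMod K) (μ : J) (x : X) :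
    |bgrad n (e μ) (bcube K ξ R k) x| ≤ |n| * (π * |s|) := by
  rw [bgrad_apply, abs_mul]
  refine mul_le_mul_of_nonneg_left ?_ (abs_nonneg _)
  rw [bcube_shift_symm K ξ R e hK hξ, bprod_shift_eq', bcube_eq_mul K ξ R k μ x, ← sub_mul, abs_mul, abs_of_nonneg (bprod_erase_mem K ξ R k μ x).1]
  refine (mul_le_of_le_one_right (abs_nonneg _) (bprod_erase_mem K ξ R k μ x).2).trans ?_
  refine (abs_bumpPer_sub_le hK R _ _).trans (le_of_eq ?_)
  rw [show ξ μ x - ((k μ).val : ℝ) - (ξ μ x - s - ((k μ).val : ℝ)) = s by ring]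

end Lattice

/-! ## §3 The identities against an input cut `χ = 1` one step beyond the support -/

section Cut

variable {X : Type}

/-- The commuted form of FILE 62's `mulOp_comp_mulOp_of_support`: if `χ = 1` wherever `a ≠ 0`, then `M_χ∘M_a = M_a`. [folklore] -/
theorem mulOp_comp_mulOp_of_support_left {a χ : X → ℝ} (h : ∀ x, a x ≠ 0 → χ x = 1) : mulOp χ ∘ₗ mulOp a = mulOp a := by
  refine LinearMap.ext fun f => funext fun x => ?_
  simp only [LinearMap.comp_apply, mulOp_apply]
  by_cases ha : a x = 0
  · rw [ha, zero_mul, mul_zero]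
  · rw [h x ha, one_mul]

variable {J : Type} [Fintype J] (K : ℕ) (ξ : J → X → ℝ) (R : ℝ) (e : J → X ≃ X) (μ : J) {χ : X → ℝ} {k : J → ZMod K}

/-- Using the cut hypothesis (`χ x = 1` whenever `x`, `e_μ x` or `e_μ⁻¹ x` lies in the open box of radius `R + 1` about `k`) at a point where `χ̃_k ≠ 0`. [folklore] -/
theorem chi_eq_one_of_bcube_ne_zero {x x₀ : X} (hχ : ∀ x : X, (∃ x₀ : X, (x₀ = x ∨ x₀ = e μ x ∨ x₀ = (e μ).symm x) ∧ ∀ ν, |cenRep K (ξ ν x₀ - ((k ν).val : ℝ))| < R + 1) → χ x = 1)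
    (hx₀ : x₀ = x ∨ x₀ = e μ x ∨ x₀ = (e μ).symm x) (hne : bcube K ξ R k x₀ ≠ 0) : χ x = 1 :=
  hχ x ⟨x₀, hx₀, abs_cenRep_lt_of_bcube_ne_zero K ξ R hne⟩

/-- ★★ `M_{χ̃_k}∘M_χ = M_{χ̃_k}` (files 44∕45's `hsub`, both grids). [cite: Balaban1985BackgroundPropagators, (3.62)–(3.65) pp.402–403 (shape)] -/
theorem bcube_cut (hχ : ∀ x : X, (∃ x₀ : X, (x₀ = x ∨ x₀ = e μ x ∨ x₀ = (e μ).symm x) ∧ ∀ ν, |cenRep K (ξ ν x₀ - ((k ν).val : ℝ))| < R + 1) → χ x = 1) :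
    mulOp (bcube K ξ R k) ∘ₗ mulOp χ = mulOp (bcube K ξ R k) :=
  mulOp_comp_mulOp_of_support fun _ hx => chi_eq_one_of_bcube_ne_zero K ξ R e μ hχ (Or.inl rfl) hx

/-- ★★ `M_χ∘M_{χ̃_k} = M_{χ̃_k}` (files 44∕45's `hχ`). [folklore] -/
theorem cut_bcube (hχ : ∀ x : X, (∃ x₀ : X, (x₀ = x ∨ x₀ = e μ x ∨ x₀ = (e μ).symm x) ∧ ∀ ν, |cenRep K (ξ ν x₀ - ((k ν).val : ℝ))| < R + 1) → χ x = 1) :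
    mulOp χ ∘ₗ mulOp (bcube K ξ R k) = mulOp (bcube K ξ R k) :=
  mulOp_comp_mulOp_of_support_left fun _ hx => chi_eq_one_of_bcube_ne_zero K ξ R e μ hχ (Or.inl rfl) hx

/-- ★★ `M_{χ̃_k∘e_μ}∘M_χ = M_{χ̃_k∘e_μ}` (files 44∕45's `hs`). [folklore] -/
theorem bcube_comp_shift_cut (hχ : ∀ x : X, (∃ x₀ : X, (x₀ = x ∨ x₀ = e μ x ∨ x₀ = (e μ).symm x) ∧ ∀ ν, |cenRep K (ξ ν x₀ - ((k ν).val : ℝ))| < R + 1) → χ x = 1) :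
    mulOp (bcube K ξ R k ∘ e μ) ∘ₗ mulOp χ = mulOp (bcube K ξ R k ∘ e μ) :=
  mulOp_comp_mulOp_of_support fun _ hx => chi_eq_one_of_bcube_ne_zero K ξ R e μ hχ (Or.inr (Or.inl rfl)) hx

/-- ★★ `M_χ∘M_{χ̃_k∘e_μ} = M_{χ̃_k∘e_μ}` (file 45's `hs2`). [folklore] -/
theorem cut_bcube_comp_shift (hχ : ∀ x : X, (∃ x₀ : X, (x₀ = x ∨ x₀ = e μ x ∨ x₀ = (e μ).symm x) ∧ ∀ ν, |cenRep K (ξ ν x₀ - ((k ν).val : ℝ))| < R + 1) → χ x = 1) :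
    mulOp χ ∘ₗ mulOp (bcube K ξ R k ∘ e μ) = mulOp (bcube K ξ R k ∘ e μ) :=
  mulOp_comp_mulOp_of_support_left fun _ hx => chi_eq_one_of_bcube_ne_zero K ξ R e μ hχ (Or.inr (Or.inl rfl)) hx

/-- ★★ `M_{χ̃_k∘e_μ⁻¹}∘M_χ = M_{χ̃_k∘e_μ⁻¹}` (files 44∕45's `hsb`). [folklore] -/
theorem bcube_comp_shift_symm_cut (hχ : ∀ x : X, (∃ x₀ : X, (x₀ = x ∨ x₀ = e μ x ∨ x₀ = (e μ).symm x) ∧ ∀ ν, |cenRep K (ξ ν x₀ - ((k ν).val : ℝ))| < R + 1) → χ x = 1) :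
    mulOp (bcube K ξ R k ∘ (e μ).symm) ∘ₗ mulOp χ = mulOp (bcube K ξ R k ∘ (e μ).symm) :=
  mulOp_comp_mulOp_of_support fun _ hx => chi_eq_one_of_bcube_ne_zero K ξ R e μ hχ (Or.inr (Or.inr rfl)) hx

/-- ★★ `M_χ∘M_{χ̃_k∘e_μ⁻¹} = M_{χ̃_k∘e_μ⁻¹}` (file 45's `hsb2`). [folklore] -/
theorem cut_bcube_comp_shift_symm (hχ : ∀ x : X, (∃ x₀ : X, (x₀ = x ∨ x₀ = e μ x ∨ x₀ = (e μ).symm x) ∧ ∀ ν, |cenRep K (ξ ν x₀ - ((k ν).val : ℝ))| < R + 1) → χ x = 1) :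
    mulOp χ ∘ₗ mulOp (bcube K ξ R k ∘ (e μ).symm) = mulOp (bcube K ξ R k ∘ (e μ).symm) :=
  mulOp_comp_mulOp_of_support_left fun _ hx => chi_eq_one_of_bcube_ne_zero K ξ R e μ hχ (Or.inr (Or.inr rfl)) hx

/-- At a point where `∇_μχ̃_k ≠ 0`, one of `χ̃_k(x)`, `χ̃_k(e_μx)` is nonzero, so `χ x = 1`. [folklore] -/
theorem chi_eq_one_of_fgrad_bcube_ne_zero (n : ℝ) {x : X}
    (hχ : ∀ x : X, (∃ x₀ : X, (x₀ = x ∨ x₀ = e μ x ∨ x₀ = (e μ).symm x) ∧ ∀ ν, |cenRep K (ξ ν x₀ - ((k ν).val : ℝ))| < R + 1) → χ x = 1)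
    (hx : fgrad n (e μ) (bcube K ξ R k) x ≠ 0) : χ x = 1 := by
  rw [fgrad_apply] at hx
  by_cases h1 : bcube K ξ R k (e μ x) = 0
  · by_cases h0 : bcube K ξ R k x = 0
    · exact absurd (by rw [h1, h0]; ring) hx
    · exact chi_eq_one_of_bcube_ne_zero K ξ R e μ hχ (Or.inl rfl) h0
  · exact chi_eq_one_of_bcube_ne_zero K ξ R e μ hχ (Or.inr (Or.inl rfl)) h1

/-- At a point where `∇⁻_μχ̃_k ≠ 0`, one of `χ̃_k(x)`, `χ̃_k(e_μ⁻¹x)` is nonzero, so `χ x = 1`. [folklore] -/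
theorem chi_eq_one_of_bgrad_bcube_ne_zero (n : ℝ) {x : X}
    (hχ : ∀ x : X, (∃ x₀ : X, (x₀ = x ∨ x₀ = e μ x ∨ x₀ = (e μ).symm x) ∧ ∀ ν, |cenRep K (ξ ν x₀ - ((k ν).val : ℝ))| < R + 1) → χ x = 1)
    (hx : bgrad n (e μ) (bcube K ξ R k) x ≠ 0) : χ x = 1 := by
  rw [bgrad_apply] at hx
  by_cases h1 : bcube K ξ R k ((e μ).symm x) = 0
  · by_cases h0 : bcube K ξ R k x = 0
    · exact absurd (by rw [h1, h0]; ring) hx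
    · exact chi_eq_one_of_bcube_ne_zero K ξ R e μ hχ (Or.inl rfl) h0
  · exact chi_eq_one_of_bcube_ne_zero K ξ R e μ hχ (Or.inr (Or.inr rfl)) h1

/-- ★★ `M_{∇_μχ̃_k}∘M_χ = M_{∇_μχ̃_k}` (files 44∕45's `hdd`). [folklore] -/
theorem fgrad_bcube_cut (n : ℝ) (hχ : ∀ x : X, (∃ x₀ : X, (x₀ = x ∨ x₀ = e μ x ∨ x₀ = (e μ).symm x) ∧ ∀ ν, |cenRep K (ξ ν x₀ - ((k ν).val : ℝ))| < R + 1) → χ x = 1) :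
    mulOp (fgrad n (e μ) (bcube K ξ R k)) ∘ₗ mulOp χ = mulOp (fgrad n (e μ) (bcube K ξ R k)) :=
  mulOp_comp_mulOp_of_support fun _ hx => chi_eq_one_of_fgrad_bcube_ne_zero K ξ R e μ n hχ hx

/-- ★★ `M_χ∘M_{∇_μχ̃_k} = M_{∇_μχ̃_k}` (file 45's `hdd2`). [folklore] -/
theorem cut_fgrad_bcube (n : ℝ) (hχ : ∀ x : X, (∃ x₀ : X, (x₀ = x ∨ x₀ = e μ x ∨ x₀ = (e μ).symm x) ∧ ∀ ν, |cenRep K (ξ ν x₀ - ((k ν).val : ℝ))| < R + 1) → χ x = 1) :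
    mulOp χ ∘ₗ mulOp (fgrad n (e μ) (bcube K ξ R k)) = mulOp (fgrad n (e μ) (bcube K ξ R k)) :=
  mulOp_comp_mulOp_of_support_left fun _ hx => chi_eq_one_of_fgrad_bcube_ne_zero K ξ R e μ n hχ hx

/-- ★★ `M_{∇⁻_μχ̃_k}∘M_χ = M_{∇⁻_μχ̃_k}` (files 44∕45's `hddb`). [folklore] -/
theorem bgrad_bcube_cut (n : ℝ) (hχ : ∀ x : X, (∃ x₀ : X, (x₀ = x ∨ x₀ = e μ x ∨ x₀ = (e μ).symm x) ∧ ∀ ν, |cenRep K (ξ ν x₀ - ((k ν).val : ℝ))| < R + 1) → χ x = 1) :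
    mulOp (bgrad n (e μ) (bcube K ξ R k)) ∘ₗ mulOp χ = mulOp (bgrad n (e μ) (bcube K ξ R k)) :=
  mulOp_comp_mulOp_of_support fun _ hx => chi_eq_one_of_bgrad_bcube_ne_zero K ξ R e μ n hχ hx

/-- ★★ `M_χ∘M_{∇⁻_μχ̃_k} = M_{∇⁻_μχ̃_k}` (file 45's `hddb2`). [folklore] -/
theorem cut_bgrad_bcube (n : ℝ) (hχ : ∀ x : X, (∃ x₀ : X, (x₀ = x ∨ x₀ = e μ x ∨ x₀ = (e μ).symm x) ∧ ∀ ν, |cenRep K (ξ ν x₀ - ((k ν).val : ℝ))| < R + 1) → χ x = 1) :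
    mulOp χ ∘ₗ mulOp (bgrad n (e μ) (bcube K ξ R k)) = mulOp (bgrad n (e μ) (bcube K ξ R k)) :=
  mulOp_comp_mulOp_of_support_left fun _ hx => chi_eq_one_of_bgrad_bcube_ne_zero K ξ R e μ n hχ hx

end Cut

/-! ## §4 The plateau contains the partition cell and its one-step neighbourhood: `M_{h_k}∘(Σ∇*∇ + W)∘M_{1−χ̃_k} = 0` -/

section Plateau

variable {X : Type} {J : Type} [Fintype J] [DecidableEq J] (K : ℕ) (ξ : J → X → ℝ) (R : ℝ) (e : J → X ≃ X) {s : ℝ}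

omit [Fintype J] [DecidableEq J] in
/-- One coordinate move changes the circle distance by at most `|s|`: `|v_K(a + δs + zK)| ≤ |v_K(a)| + |s|`-type bound. [folklore] -/
theorem abs_cenRep_shift_le (hK : 0 < K) (a c : ℝ) (z : ℤ) : |cenRep K (a + c + z * K)| ≤ |cenRep K a| + |c| := by
  rw [cenRep_add_int_mul hK]
  have h := abs_abs_cenRep_sub_le hK (a + c) a
  rw [show a + c - a = c by ring] at h
  have := abs_le.1 h
  linarith

/-- ★★ **THE PLATEAU COVERS THE CELL AND ITS NEIGHBOURS**: for `R ≥ 1 + |s|`, `h_k(x) ≠ 0` ⟹ `χ̃_k(x₀) = 1` for `x₀ ∈ {x, e_μx, e_μ⁻¹x}` (FILE 62: the cell is the open unit box;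
one shift moves one coordinate by `±s` mod `K`). [cite: Balaban1984PropagatorsII, (2.36) p.229 (supp h_□ ⊂ □), (2.91) p.239 (mechanism)] -/
theorem bcube_eq_one_of_hcube_ne_zero (hK : 0 < K) (hξ : ∀ μ ν x, ∃ z : ℤ, ξ ν (e μ x) = ξ ν x + (if ν = μ then s else 0) + z * K) (hR : 1 + |s| ≤ R)
    {k : J → ZMod K} (μ : J) {x x₀ : X} (hx₀ : x₀ = x ∨ x₀ = e μ x ∨ x₀ = (e μ).symm x) (hne : hcube K ξ k x ≠ 0) : bcube K ξ R k x₀ = 1 := by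
  classical
  have hcell := abs_cenRep_lt_one_of_hcube_ne_zero K ξ hne
  have hδ : ∀ ν, |(if ν = μ then s else 0)| ≤ |s| := fun ν => by split_ifs <;> simp
  refine bcube_eq_one_of_forall_abs_cenRep_le K ξ R fun ν => ?_
  rcases hx₀ with rfl | rfl | rfl
  · linarith [hcell ν, abs_nonneg s]
  · obtain ⟨z, hz⟩ := hξ μ ν x
    rw [hz, show ξ ν x + (if ν = μ then s else 0) + z * K - ((k ν).val : ℝ) = (ξ ν x - ((k ν).val : ℝ)) + (if ν = μ then s else 0) + z * K by ring]
    linarith [abs_cenRep_shift_le K hK (ξ ν x - ((k ν).val : ℝ)) (if ν = μ then s else 0) z, hcell ν, hδ ν]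
  · obtain ⟨z, hz⟩ := hξ μ ν ((e μ).symm x)
    rw [Equiv.apply_symm_apply] at hz
    have e1 : ξ ν ((e μ).symm x) - ((k ν).val : ℝ) = (ξ ν x - ((k ν).val : ℝ)) + (-(if ν = μ then s else 0)) + (-z : ℤ) * K := by push_cast; linarith
    rw [e1]
    have h2 := abs_cenRep_shift_le K hK (ξ ν x - ((k ν).val : ℝ)) (-(if ν = μ then s else 0)) (-z)
    rw [abs_neg] at h2
    linarith [hcell ν, hδ ν]

/-- ★★ **NESTED BUMPS — A WIDER BUMP IS AN ADMISSIBLE INPUT CUT**: for `R′ ≥ R + 1 + |s|` the sampled bump of radius `R′` equals `1` at every `x` one of whose points `x, e_μx, e_μ⁻¹x`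
lies in the open box of radius `R + 1` about `k` — i.e. `χ := χ̃^{R′}_k` satisfies §3's cut hypothesis for `χ̃^{R}_k` (non-vacuity of `hsub … hddb2` on any carrier with FILE 61's `hξ`).
[cite: Balaban1985BackgroundPropagators, (3.62)–(3.65) pp.402–403 (nested cut-offs: shape)] -/
theorem bcube_wider_eq_one_of_near_box (hK : 0 < K) (hξ : ∀ μ ν x, ∃ z : ℤ, ξ ν (e μ x) = ξ ν x + (if ν = μ then s else 0) + z * K) {R' : ℝ} (hR' : R + 1 + |s| ≤ R')
    (k : J → ZMod K) (μ : J) (x : X) (hx : ∃ x₀ : X, (x₀ = x ∨ x₀ = e μ x ∨ x₀ = (e μ).symm x) ∧ ∀ ν, |cenRep K (ξ ν x₀ - ((k ν).val : ℝ))| < R + 1) :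
    bcube K ξ R' k x = 1 := by
  classical
  obtain ⟨x₀, hx₀, hbox⟩ := hx
  have hδ : ∀ ν, |(if ν = μ then s else 0)| ≤ |s| := fun ν => by split_ifs <;> simp
  refine bcube_eq_one_of_forall_abs_cenRep_le K ξ R' fun ν => ?_
  rcases hx₀ with rfl | rfl | rfl
  · linarith [hbox ν, abs_nonneg s]
  · -- `x₀ = e_μ x`: `ξ_ν x − k_ν = (ξ_ν x₀ − k_ν) − δs − zK`
    obtain ⟨z, hz⟩ := hξ μ ν x
    have e1 : ξ ν x - ((k ν).val : ℝ) = (ξ ν (e μ x) - ((k ν).val : ℝ)) + (-(if ν = μ then s else 0)) + (-z : ℤ) * K := by push_cast; linarith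
    rw [e1]
    have h2 := abs_cenRep_shift_le K hK (ξ ν (e μ x) - ((k ν).val : ℝ)) (-(if ν = μ then s else 0)) (-z)
    rw [abs_neg] at h2
    linarith [hbox ν, hδ ν]
  · -- `x₀ = e_μ⁻¹ x`: `ξ_ν x − k_ν = (ξ_ν x₀ − k_ν) + δs + zK`
    obtain ⟨z, hz⟩ := hξ μ ν ((e μ).symm x)
    rw [Equiv.apply_symm_apply] at hz
    rw [hz, show ξ ν ((e μ).symm x) + (if ν = μ then s else 0) + z * K - ((k ν).val : ℝ) = (ξ ν ((e μ).symm x) - ((k ν).val : ℝ)) + (if ν = μ then s else 0) + z * K by ring]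
    linarith [abs_cenRep_shift_le K hK (ξ ν ((e μ).symm x) - ((k ν).val : ℝ)) (if ν = μ then s else 0) z, hbox ν, hδ ν]

omit [Fintype J] [DecidableEq J] in
/-- ★★ **THE DIRECTIONAL PLATEAU IDENTITY** `M_h∘∇*_μ∇_μ∘M_{1−χ̃} = 0` whenever `χ̃ = 1` at `x, e_μx, e_μ⁻¹x` for every `x` with `h(x) ≠ 0` (the three-point stencil of `∇*∇` stays in the
plateau). [cite: Balaban1984PropagatorsII, (2.91) p.239 (mechanism); Balaban1984PropagatorsI, (1.3) p.18 (stencil: shape)] -/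
theorem mulOp_comp_lapDir_comp_mulOp_one_sub_eq_zero (n : ℝ) (eμ : X ≃ X) {h χt : X → ℝ}
    (hpl : ∀ x, h x ≠ 0 → χt x = 1 ∧ χt (eμ x) = 1 ∧ χt (eμ.symm x) = 1) : mulOp h ∘ₗ lapDir n eμ ∘ₗ mulOp (1 - χt) = 0 := by
  refine LinearMap.ext fun f => funext fun x => ?_
  simp only [lapDir, LinearMap.comp_apply, LinearMap.zero_apply, Pi.zero_apply, mulOp_apply, fgradAdj_apply, fgrad_apply, Equiv.apply_symm_apply, Pi.sub_apply,
    Pi.one_apply]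
  by_cases hh : h x = 0
  · rw [hh, zero_mul]
  · obtain ⟨h0, h1, h2⟩ := hpl x hh
    rw [h0, h1, h2]; ring

omit [DecidableEq J] in
/-- ★★ **THE PLATEAU IDENTITY FOR `Σ∇*∇ + W`**: the same three-point plateau property in every direction plus the displayed locality `M_h∘W∘M_{1−χ̃} = 0` of the potential part ⟹
`M_h∘lapOp n e W∘M_{1−χ̃} = 0`. [cite: Balaban1984PropagatorsII, (2.91) p.239 (mechanism); Balaban1985BackgroundPropagators, (3.26) p.395 (shape)] -/
theorem mulOp_comp_lapOp_comp_mulOp_one_sub_eq_zero (n : ℝ) (W : (X → ℝ) →ₗ[ℝ] (X → ℝ)) {h χt : X → ℝ}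
    (hpl : ∀ μ x, h x ≠ 0 → χt x = 1 ∧ χt (e μ x) = 1 ∧ χt ((e μ).symm x) = 1) (hW : mulOp h ∘ₗ W ∘ₗ mulOp (1 - χt) = 0) :
    mulOp h ∘ₗ lapOp n e W ∘ₗ mulOp (1 - χt) = 0 := by
  have hdir : ∀ μ, mulOp h ∘ₗ lapDir n (e μ) ∘ₗ mulOp (1 - χt) = 0 := fun μ => mulOp_comp_lapDir_comp_mulOp_one_sub_eq_zero n (e μ) (hpl μ)
  refine LinearMap.ext fun f => ?_
  have hWf : mulOp h (W (mulOp (1 - χt) f)) = 0 := by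
    have := LinearMap.congr_fun hW f; simpa only [LinearMap.comp_apply, LinearMap.zero_apply] using this
  have hdf : ∀ μ, mulOp h (lapDir n (e μ) (mulOp (1 - χt) f)) = 0 := fun μ => by
    have := LinearMap.congr_fun (hdir μ) f; simpa only [LinearMap.comp_apply, LinearMap.zero_apply] using this
  simp only [lapOp, LinearMap.comp_apply, LinearMap.add_apply, LinearMap.coe_sum, Finset.sum_apply, map_add, map_sum, LinearMap.zero_apply, hWf, hdf,
    Finset.sum_const_zero, add_zero]

omit [Fintype J] [DecidableEq J] in
/-- A multiplication operator is local: `M_h∘M_w∘M_{1−χ̃} = 0` as soon as `χ̃ = 1` on the support of `h`. [folklore] -/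
theorem mulOp_comp_mulOp_comp_mulOp_one_sub_eq_zero {h χt : X → ℝ} (w : X → ℝ) (hpl : ∀ x, h x ≠ 0 → χt x = 1) : mulOp h ∘ₗ mulOp w ∘ₗ mulOp (1 - χt) = 0 := by
  refine LinearMap.ext fun f => funext fun x => ?_
  simp only [LinearMap.comp_apply, LinearMap.zero_apply, Pi.zero_apply, mulOp_apply, Pi.sub_apply, Pi.one_apply]
  by_cases hh : h x = 0
  · rw [hh, zero_mul]
  · rw [hpl x hh]; ring

/-- ★★★ **files 44∕45's `hL` FOR THE SAMPLED PARTITION AND BUMP**: `R ≥ 1 + |s|` and `M_{h_k}∘W∘M_{1−χ̃_k} = 0` ⟹ `M_{h_k}∘lapOp n e W∘M_{1−χ̃_k} = 0` with `h_k = hcube K ξ k`,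
`χ̃_k = bcube K ξ R k`. [cite: Balaban1984PropagatorsII, (2.36) p.229, (2.91) p.239 (mechanism); Balaban1985BackgroundPropagators, (3.62)–(3.65) pp.402–403 (shape)] -/
theorem mulOp_hcube_comp_lapOp_comp_one_sub_bcube (hK : 0 < K) (hξ : ∀ μ ν x, ∃ z : ℤ, ξ ν (e μ x) = ξ ν x + (if ν = μ then s else 0) + z * K) (hR : 1 + |s| ≤ R)
    (n : ℝ) (W : (X → ℝ) →ₗ[ℝ] (X → ℝ)) (k : J → ZMod K) (hW : mulOp (hcube K ξ k) ∘ₗ W ∘ₗ mulOp (1 - bcube K ξ R k) = 0) :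
    mulOp (hcube K ξ k) ∘ₗ lapOp n e W ∘ₗ mulOp (1 - bcube K ξ R k) = 0 :=
  mulOp_comp_lapOp_comp_mulOp_one_sub_eq_zero e n W
    (fun μ _ hx => ⟨bcube_eq_one_of_hcube_ne_zero K ξ R e hK hξ hR μ (Or.inl rfl) hx, bcube_eq_one_of_hcube_ne_zero K ξ R e hK hξ hR μ (Or.inr (Or.inl rfl)) hx,
      bcube_eq_one_of_hcube_ne_zero K ξ R e hK hξ hR μ (Or.inr (Or.inr rfl)) hx⟩) hW

/-- ★★ The directional form for the sampled pair: `M_{h_k}∘∇*_μ∇_μ∘M_{1−χ̃_k} = 0` (`R ≥ 1 + |s|`). [cite: Balaban1984PropagatorsII, (2.91) p.239 (mechanism)] -/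
theorem mulOp_hcube_comp_lapDir_comp_one_sub_bcube (hK : 0 < K) (hξ : ∀ μ ν x, ∃ z : ℤ, ξ ν (e μ x) = ξ ν x + (if ν = μ then s else 0) + z * K) (hR : 1 + |s| ≤ R)
    (n : ℝ) (k : J → ZMod K) (μ : J) : mulOp (hcube K ξ k) ∘ₗ lapDir n (e μ) ∘ₗ mulOp (1 - bcube K ξ R k) = 0 :=
  mulOp_comp_lapDir_comp_mulOp_one_sub_eq_zero n (e μ) fun _ hx =>
    ⟨bcube_eq_one_of_hcube_ne_zero K ξ R e hK hξ hR μ (Or.inl rfl) hx, bcube_eq_one_of_hcube_ne_zero K ξ R e hK hξ hR μ (Or.inr (Or.inl rfl)) hx,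
      bcube_eq_one_of_hcube_ne_zero K ξ R e hK hξ hR μ (Or.inr (Or.inr rfl)) hx⟩

omit [DecidableEq J] in
/-- The plateau covers the cell itself as soon as `R ≥ 1`: `h_k(x) ≠ 0 ⟹ χ̃_k(x) = 1`. [cite: Balaban1984PropagatorsII, (2.36) p.229 (supp h_□ ⊂ □: shape)] -/
theorem bcube_eq_one_of_hcube_ne_zero_self (hR : 1 ≤ R) {k : J → ZMod K} {x : X} (hne : hcube K ξ k x ≠ 0) : bcube K ξ R k x = 1 :=
  bcube_eq_one_of_forall_abs_cenRep_le K ξ R fun ν => by linarith [abs_cenRep_lt_one_of_hcube_ne_zero K ξ hne ν]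

/-- ★★ … and with a multiplication operator as the potential part: `M_{h_k}∘(Σ∇*∇ + M_w)∘M_{1−χ̃_k} = 0` with NO further hypothesis (`R ≥ 1 + |s|`). [cite: Balaban1985BackgroundPropagators, (3.26) p.395 (shape)] -/
theorem mulOp_hcube_comp_lapOp_mulOp_comp_one_sub_bcube (hK : 0 < K) (hξ : ∀ μ ν x, ∃ z : ℤ, ξ ν (e μ x) = ξ ν x + (if ν = μ then s else 0) + z * K) (hR : 1 + |s| ≤ R)
    (n : ℝ) (w : X → ℝ) (k : J → ZMod K) : mulOp (hcube K ξ k) ∘ₗ lapOp n e (mulOp w) ∘ₗ mulOp (1 - bcube K ξ R k) = 0 :=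
  mulOp_hcube_comp_lapOp_comp_one_sub_bcube K ξ R e hK hξ hR n (mulOp w) k
    (mulOp_comp_mulOp_comp_mulOp_one_sub_eq_zero w fun _ hx => bcube_eq_one_of_hcube_ne_zero_self K ξ R (by linarith [abs_nonneg s]) hx)

end Plateau

end Summit.QuantumFields.YangMills.BalabanUVNodes.N15.Gluing

end
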